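import Summits.Ventures.LatticeQCDFlow.Scoring.AlternantTorusExpansion
import Summits.Ventures.LatticeQCDFlow.Scoring.SUNTorusBesselSeries
import Summits.Ventures.LatticeQCDFlow.Scoring.UNTopologicalDensityFluxSeries
import HarnessLib

/-!
# The `SU(N)` character coefficients of the Wilson weight, for every `N`: `∫ e^{x Σcos φ} conj s_λ(e^{iφ}) |Δ(φ)|² dθ = (2π)^{N−1} N! Σ_q det[I_{|λ_j − j + i + q|}(x)]`

HONEST FRAMING: exact (Metropolis-corrected) sampling algorithms for lattice gauge theory;
figures of merit are autocorrelation/cost numbers at stated couplings and volumes; no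
continuum-physics claim.

Venture `LatticeQCDFlow` (cell pub-lqcd), sub-topic `Scoring`; FANOUT row 5 (`s0-sun-a`), GEN-23.
NEW WORK of the cell (placement rule).  The `SU(N)` twin of `UNCharacterCoefficients`, on the maximal torus `SΔ(N)`
with one dependent eigen-phase `φ_{i₀} = −Σ_{b≠i₀} θ_b` (GEN-17's `SUNTorusBesselSeries`, which is the case
`α = β = ρ` below): for all exponent vectors `α, β : Fin N → ℕ` and real `x`,

* `integral_cube_prod_cexp_cos_mul_alternant_mul_conj_alternant_ext`:
  **`∫_{(−π,π]^{N−1}} (Π_b e^{x cos φ_b}) a_α(e^{iφ}) conj a_β(e^{iφ}) dθ = (2π)^{N−1} N! Σ_{q∈ℤ} det[I_{|α_i − β_j − q|}(x)]`**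
  (double Leibniz expansion from `AlternantTorusExpansion`, GEN-17's twisted one-plaquette integral over the free
  phases `integral_cube_prod_cexp_cos_mul_cexp_ext`, Andréief's identity under the `q`-sum);
* `integral_cube_alternant_mul_conj_alternant_ext` (`x = 0`): **WEYL'S ORTHOGONALITY ON `SU(N)`** —
  `∫ a_{λ+ρ} conj a_{μ+ρ} dθ = (2π)^{N−1} N! [λ − μ constant]`: two `U(N)` characters are orthogonal on `SU(N)` unless
  they differ by a power of `det`, in which case they coincide there (`I_k(0) = [k = 0]`, and a strictly decreasing
  exponent vector matched entrywise into another is a constant shift of it);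
* `integral_cube_prod_cexp_cos_mul_conj_schur_mul_norm_sq_ext`: **THE `SU(N)` CHARACTER COEFFICIENTS OF THE
  ONE-PLAQUETTE WEIGHT FOR EVERY `N`** — `∫ (Π_b e^{x cos φ_b}) conj s_λ(e^{iφ}) |a_ρ(e^{iφ})|² dθ =
  (2π)^{N−1} N! Σ_q det[I_{|ρ_i − λ_j − ρ_j − q|}(x)]`, i.e. with Weyl's formula for `SU(N)`
  `⟨χ_λ, e^{x Re tr V}⟩_{SU(N)} = Σ_{q∈ℤ} det[I_{|λ_j − j + i + q|}(x)]` (Drouffe–Zuber 1983, (3.8); `λ = 0`: the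
  Bars–Green series of GEN-17; `N = 3`: all higher-representation coefficients of the `SU(3)` character expansion
  beyond GEN-16's fundamental one).

No `def`, no named fact, 0 sorry.
-/

noncomputable section

open Real MeasureTheory Finset Complex Equiv
open scoped ENNReal ComplexConjugate
open Literature.Analysis.FunctionSpaces
open Literature.RepresentationTheory.CompactGroups.WeylIntegration
open Literature.RingTheory.SymmetricFunctions.SymmPoly (alternant rho schur alternant_add_rho)

namespace Summit.Ventures.LatticeQCDFlow.Scoring

variable {N : ℕ} (i₀ : Fin N)

/-- Each term of the double Leibniz expansion, weighted, is integrable on the free cube (general twist `m`). -/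
theorem integrable_cube_weighted_term_ext' (x : ℝ) (m : Fin N → ℤ) :
    Integrable (fun θ : {i : Fin N // i ≠ i₀} → ℝ =>
        ∏ b, (cexp ((x : ℂ) * Real.cos (if h : b = i₀ then -∑ k, θ k else θ ⟨b, h⟩)) *
          cexp ((m b : ℂ) * ((if h : b = i₀ then -∑ k, θ k else θ ⟨b, h⟩ : ℝ) : ℂ) * I)))
      (Measure.pi fun _ : {i : Fin N // i ≠ i₀} => (volume : Measure ℝ).restrict (Set.Ioc (-π) π)) := by
  refine Integrable.mono' (integrable_const ((Real.exp |x|) ^ Fintype.card (Fin N))) ?_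
    (Filter.Eventually.of_forall fun θ => ?_)
  · refine Continuous.aestronglyMeasurable (continuous_finsetProd _ fun b _ => ?_)
    have hc := continuous_ext_apply i₀ b
    exact ((continuous_const.mul (Complex.continuous_ofReal.comp (Real.continuous_cos.comp hc))).cexp).mul
      (((continuous_const.mul (Complex.continuous_ofReal.comp hc)).mul continuous_const).cexp)
  · rw [norm_prod, ← Finset.card_univ, ← Finset.prod_const]
    exact Finset.prod_le_prod (fun b _ => norm_nonneg _) fun b _ => norm_cexp_cos_mul_cexp_le x _ _

/-- **THE WEIGHTED ALTERNANT PAIRING ON THE `SU(N)` TORUS**: for every real `x` and exponent vectors `α, β`,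
`∫_{(−π,π]^{N∖i₀}} (Π_b e^{x cos φ_b}) a_α(e^{iφ}) conj a_β(e^{iφ}) dθ = (2π)^{N−1} · N! · Σ_{q∈ℤ} det[I_{|α_i − β_j − q|}(x)]`,
`φ_b = θ_b` (`b ≠ i₀`), `φ_{i₀} = −Σθ`. -/
theorem integral_cube_prod_cexp_cos_mul_alternant_mul_conj_alternant_ext (x : ℝ) (α β : Fin N → ℕ) :
    ∫ θ, (∏ b, cexp ((x : ℂ) * Real.cos (if h : b = i₀ then -∑ k, θ k else θ ⟨b, h⟩))) *
        (alternant (fun b => cexp (((if h : b = i₀ then -∑ k, θ k else θ ⟨b, h⟩ : ℝ) : ℂ) * I)) α *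
          conj (alternant (fun b => cexp (((if h : b = i₀ then -∑ k, θ k else θ ⟨b, h⟩ : ℝ) : ℂ) * I)) β))
        ∂(Measure.pi fun _ : {i : Fin N // i ≠ i₀} => (volume : Measure ℝ).restrict (Set.Ioc (-π) π))
      = (2 * π : ℂ) ^ Fintype.card {i : Fin N // i ≠ i₀} * N.factorial *
          ∑' q : ℤ, (Matrix.of fun i j : Fin N => (besselI (((α i : ℕ) : ℤ) - ((β j : ℕ) : ℤ) - q).natAbs x : ℂ)).det := by
  have hexp := fun θ : {i : Fin N // i ≠ i₀} → ℝ =>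
    prod_cexp_cos_mul_alternant_mul_conj_alternant_eq_sum x α β (fun b => if h : b = i₀ then -∑ k, θ k else θ ⟨b, h⟩)
  simp_rw [hexp]
  rw [integral_finsetSum _ (fun σ _ => integrable_finsetSum _ fun τ _ =>
    (integrable_cube_weighted_term_ext' i₀ x _).const_mul _)]
  simp_rw [integral_finsetSum _ (fun τ _ => (integrable_cube_weighted_term_ext' i₀ x _).const_mul _),
    integral_const_mul]
  have hI : ∀ σ τ : Perm (Fin N),
      ∫ θ : {i : Fin N // i ≠ i₀} → ℝ, ∏ b, (cexp ((x : ℂ) * Real.cos (if h : b = i₀ then -∑ k, θ k else θ ⟨b, h⟩)) *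
            cexp (((((α (σ.symm b) : ℕ) : ℤ) - ((β (τ.symm b) : ℕ) : ℤ) : ℤ) : ℂ) *
              ((if h : b = i₀ then -∑ k, θ k else θ ⟨b, h⟩ : ℝ) : ℂ) * I))
        ∂(Measure.pi fun _ : {i : Fin N // i ≠ i₀} => (volume : Measure ℝ).restrict (Set.Ioc (-π) π))
      = (2 * π : ℂ) ^ Fintype.card {i : Fin N // i ≠ i₀} *
          ∑' q : ℤ, ∏ b, (besselI ((((α (σ.symm b) : ℕ) : ℤ) - ((β (τ.symm b) : ℕ) : ℤ)) - q).natAbs x : ℂ) :=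
    fun σ τ => integral_cube_prod_cexp_cos_mul_cexp_ext i₀ x (fun b => ((α (σ.symm b) : ℕ) : ℤ) - ((β (τ.symm b) : ℕ) : ℤ))
  simp_rw [hI]
  have hsum : ∀ σ τ : Perm (Fin N), Summable fun q : ℤ => ((Equiv.Perm.sign σ : ℤ) : ℂ) * ((Equiv.Perm.sign τ : ℤ) : ℂ) *
      ∏ b, (besselI ((((α (σ.symm b) : ℕ) : ℤ) - ((β (τ.symm b) : ℕ) : ℤ)) - q).natAbs x : ℂ) :=
    fun σ τ => ((summable_norm_prod_besselI_sub i₀ x _).of_norm).mul_left _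
  have hterm : ∀ σ τ : Perm (Fin N), ((Equiv.Perm.sign σ : ℤ) : ℂ) * ((Equiv.Perm.sign τ : ℤ) : ℂ) *
      ((2 * π : ℂ) ^ Fintype.card {i : Fin N // i ≠ i₀} *
        ∑' q : ℤ, ∏ b, (besselI ((((α (σ.symm b) : ℕ) : ℤ) - ((β (τ.symm b) : ℕ) : ℤ)) - q).natAbs x : ℂ))
      = (2 * π : ℂ) ^ Fintype.card {i : Fin N // i ≠ i₀} *
        ∑' q : ℤ, (((Equiv.Perm.sign σ : ℤ) : ℂ) * ((Equiv.Perm.sign τ : ℤ) : ℂ) *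
          ∏ b, (besselI ((((α (σ.symm b) : ℕ) : ℤ) - ((β (τ.symm b) : ℕ) : ℤ)) - q).natAbs x : ℂ)) := by
    intro σ τ
    rw [tsum_mul_left]
    ring
  simp_rw [hterm]
  simp only [← Finset.mul_sum]
  rw [mul_assoc]
  congr 1
  symm
  calc (N.factorial : ℂ) * ∑' q : ℤ, (Matrix.of fun i j : Fin N =>
          (besselI (((α i : ℕ) : ℤ) - ((β j : ℕ) : ℤ) - q).natAbs x : ℂ)).det
      = ∑' q : ℤ, (N.factorial : ℂ) * (Matrix.of fun i j : Fin N =>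
          (besselI (((α i : ℕ) : ℤ) - ((β j : ℕ) : ℤ) - q).natAbs x : ℂ)).det := tsum_mul_left.symm
    _ = ∑' q : ℤ, ∑ σ : Perm (Fin N), ∑ τ : Perm (Fin N), ((Equiv.Perm.sign σ : ℤ) : ℂ) * ((Equiv.Perm.sign τ : ℤ) : ℂ) *
          ∏ b, (besselI ((((α (σ.symm b) : ℕ) : ℤ) - ((β (τ.symm b) : ℕ) : ℤ)) - q).natAbs x : ℂ) := by
        refine tsum_congr fun q => ?_
        have key := sum_sum_sign_mul_sign_mul_prod_eq_factorial_mul_det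
          (Matrix.of fun i j : Fin N => (besselI (((α i : ℕ) : ℤ) - ((β j : ℕ) : ℤ) - q).natAbs x : ℂ))
        simp only [Matrix.of_apply, Fintype.card_fin] at key
        rw [← key]
    _ = ∑ σ : Perm (Fin N), ∑' q : ℤ, ∑ τ : Perm (Fin N), ((Equiv.Perm.sign σ : ℤ) : ℂ) * ((Equiv.Perm.sign τ : ℤ) : ℂ) *
          ∏ b, (besselI ((((α (σ.symm b) : ℕ) : ℤ) - ((β (τ.symm b) : ℕ) : ℤ)) - q).natAbs x : ℂ) :=
        Summable.tsum_finsetSum fun σ _ => summable_sum fun τ _ => hsum σ τ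
    _ = ∑ σ : Perm (Fin N), ∑ τ : Perm (Fin N), ∑' q : ℤ, ((Equiv.Perm.sign σ : ℤ) : ℂ) * ((Equiv.Perm.sign τ : ℤ) : ℂ) *
          ∏ b, (besselI ((((α (σ.symm b) : ℕ) : ℤ) - ((β (τ.symm b) : ℕ) : ℤ)) - q).natAbs x : ℂ) :=
        Finset.sum_congr rfl fun σ _ => Summable.tsum_finsetSum fun τ _ => hsum σ τ

/-- **THE `SU(N)` CHARACTER COEFFICIENTS OF THE WILSON ONE-PLAQUETTE WEIGHT, FOR EVERY `N`**:
`∫_{(−π,π]^{N∖i₀}} (Π_b e^{x cos φ_b}) conj s_λ(e^{iφ}) |a_ρ(e^{iφ})|² dθ = (2π)^{N−1} N! Σ_{q∈ℤ} det[I_{|ρ_i − λ_j − ρ_j − q|}(x)]`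
— with Weyl's formula for `SU(N)`: `∫_{SU(N)} e^{x Re tr V} conj χ_λ(V) dV = Σ_{q∈ℤ} det[I_{|λ_j − j + i + q|}(x)]`. -/
theorem integral_cube_prod_cexp_cos_mul_conj_schur_mul_norm_sq_ext (x : ℝ) (la : Fin N → ℕ) :
    ∫ θ, (∏ b, cexp ((x : ℂ) * Real.cos (if h : b = i₀ then -∑ k, θ k else θ ⟨b, h⟩))) *
        (conj (schur (fun b => cexp (((if h : b = i₀ then -∑ k, θ k else θ ⟨b, h⟩ : ℝ) : ℂ) * I)) la) *
          ((‖alternant (fun b => cexp (((if h : b = i₀ then -∑ k, θ k else θ ⟨b, h⟩ : ℝ) : ℂ) * I)) (rho N)‖ ^ 2 : ℝ) : ℂ))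
        ∂(Measure.pi fun _ : {i : Fin N // i ≠ i₀} => (volume : Measure ℝ).restrict (Set.Ioc (-π) π))
      = (2 * π : ℂ) ^ Fintype.card {i : Fin N // i ≠ i₀} * N.factorial *
          ∑' q : ℤ, (Matrix.of fun i j : Fin N =>
            (besselI (((rho N i : ℕ) : ℤ) - (((la + rho N) j : ℕ) : ℤ) - q).natAbs x : ℂ)).det := by
  rw [← integral_cube_prod_cexp_cos_mul_alternant_mul_conj_alternant_ext i₀ x (rho N) (la + rho N)]
  refine integral_congr_ae (Filter.Eventually.of_forall fun θ => ?_)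
  dsimp only
  rw [alternant_add_rho, map_mul, ← Complex.normSq_eq_norm_sq, ← Complex.mul_conj]
  ring

/-! ### Weyl's orthogonality on `SU(N)`: `U(N)` characters that differ by a power of `det` coincide -/

/-- `I_{|k|}(0) = [k = 0]`. -/
theorem besselI_natAbs_zero (k : ℤ) : besselI k.natAbs 0 = if k = 0 then 1 else 0 := by
  split_ifs with h
  · rw [h, Int.natAbs_zero, besselI_zero_apply_zero]
  · exact besselI_apply_zero_of_ne_zero (Int.natAbs_ne_zero.mpr h)

/-- At `x = 0` the shifted determinant `det[I_{|α_i − β_j − q|}(0)]` of two strictly decreasing exponent vectors is `1`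
if `α = β + q` (constant shift) and `0` otherwise. -/
theorem det_besselI_sub_sub_zero {la mu : Fin N → ℕ} (hla : Antitone la) (hmu : Antitone mu) (q : ℤ) :
    (Matrix.of fun i j : Fin N => (besselI ((((la + rho N) i : ℕ) : ℤ) - (((mu + rho N) j : ℕ) : ℤ) - q).natAbs 0 : ℂ)).det
      = if ∀ i, (((la + rho N) i : ℕ) : ℤ) = (((mu + rho N) i : ℕ) : ℤ) + q then 1 else 0 := by
  have hs := Literature.RingTheory.SymmetricFunctions.SymmPoly.strictAnti_add_rho hla
  have hs' := Literature.RingTheory.SymmetricFunctions.SymmPoly.strictAnti_add_rho hmu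
  set α : Fin N → ℤ := fun i => (((la + rho N) i : ℕ) : ℤ) with hα
  set β : Fin N → ℤ := fun j => (((mu + rho N) j : ℕ) : ℤ) + q with hβ
  have hαs : StrictAnti α := fun i j hij => by simp only [hα]; exact_mod_cast hs hij
  have hβs : StrictAnti β := fun i j hij => by simp only [hβ]; have := hs' hij; omega
  have hM : (Matrix.of fun i j : Fin N => (besselI ((((la + rho N) i : ℕ) : ℤ) - (((mu + rho N) j : ℕ) : ℤ) - q).natAbs 0 : ℂ))
      = Matrix.of fun i j : Fin N => if α i = β j then (1 : ℂ) else 0 := by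
    ext i j
    simp only [Matrix.of_apply, besselI_natAbs_zero, hα, hβ]
    by_cases h : (((la + rho N) i : ℕ) : ℤ) = (((mu + rho N) j : ℕ) : ℤ) + q
    · rw [if_pos (by omega), if_pos h, Complex.ofReal_one]
    · rw [if_neg (by omega), if_neg h, Complex.ofReal_zero]
  rw [hM]
  by_cases hq : ∀ i, α i = β i
  · rw [if_pos (fun i => by have := hq i; simp only [hα, hβ] at this; exact this)]
    have h1 : (Matrix.of fun i j : Fin N => if α i = β j then (1 : ℂ) else 0) = 1 := by
      ext i j
      rw [Matrix.of_apply, hq i, Matrix.one_apply]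
      exact if_congr hβs.injective.eq_iff rfl rfl
    rw [h1, Matrix.det_one]
  · rw [if_neg (fun h => hq fun i => by simp only [hα, hβ]; exact h i)]
    -- some row of the matrix vanishes
    by_contra hdet
    apply hq
    have hrow : ∀ i, ∃ j, α i = β j := by
      intro i
      by_contra hi
      push Not at hi
      exact hdet (Matrix.det_eq_zero_of_row_eq_zero i fun j => by rw [Matrix.of_apply, if_neg (hi j)])
    have hsub : Set.range α ⊆ Set.range β := by
      rintro _ ⟨i, rfl⟩
      obtain ⟨j, hj⟩ := hrow i
      exact ⟨j, hj.symm⟩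
    have hcard : (Finset.univ.image β).card ≤ (Finset.univ.image α).card := by
      rw [Finset.card_image_of_injective _ hβs.injective, Finset.card_image_of_injective _ hαs.injective]
    have hsubF : Finset.univ.image α ⊆ Finset.univ.image β := by
      intro y hy
      rw [Finset.mem_image] at hy ⊢
      obtain ⟨i, -, rfl⟩ := hy
      obtain ⟨j, hj⟩ := hrow i
      exact ⟨j, Finset.mem_univ _, hj.symm⟩
    have heqF := Finset.eq_of_subset_of_card_le hsubF hcard
    have hrange : Set.range α = Set.range β := by
      have h1 : Set.range α = ↑(Finset.univ.image α) := by rw [Finset.coe_image, Finset.coe_univ, Set.image_univ]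
      have h2 : Set.range β = ↑(Finset.univ.image β) := by rw [Finset.coe_image, Finset.coe_univ, Set.image_univ]
      rw [h1, h2, heqF]
    exact congrFun ((hαs.range_inj hβs).mp hrange)

/-- **WEYL'S ORTHOGONALITY OF THE `SU(N)` CHARACTERS, ANGLE FORM** (`N ≥ 1`): for antitone `λ, μ`,
`∫_{(−π,π]^{N∖i₀}} s_λ(e^{iφ})‾·… ` — precisely
`∫ a_{λ+ρ}(e^{iφ}) conj a_{μ+ρ}(e^{iφ}) dθ = (2π)^{N−1} N! · [λ − μ is constant]`: two `U(N)` characters are orthogonal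
on `SU(N)` unless they differ by a power of the determinant, in which case they coincide there. -/
theorem integral_cube_alternant_mul_conj_alternant_ext [NeZero N] {la mu : Fin N → ℕ} (hla : Antitone la)
    (hmu : Antitone mu) :
    ∫ θ, alternant (fun b => cexp (((if h : b = i₀ then -∑ k, θ k else θ ⟨b, h⟩ : ℝ) : ℂ) * I)) (la + rho N) *
        conj (alternant (fun b => cexp (((if h : b = i₀ then -∑ k, θ k else θ ⟨b, h⟩ : ℝ) : ℂ) * I)) (mu + rho N))
        ∂(Measure.pi fun _ : {i : Fin N // i ≠ i₀} => (volume : Measure ℝ).restrict (Set.Ioc (-π) π))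
      = (2 * π : ℂ) ^ Fintype.card {i : Fin N // i ≠ i₀} * N.factorial *
          (if ∀ i, (la i : ℤ) - mu i = (la 0 : ℤ) - mu 0 then 1 else 0) := by
  have h0 := integral_cube_prod_cexp_cos_mul_alternant_mul_conj_alternant_ext i₀ 0 (la + rho N) (mu + rho N)
  simp only [Complex.ofReal_zero, zero_mul, Complex.exp_zero, Finset.prod_const_one, one_mul] at h0
  rw [h0]
  congr 1
  simp_rw [det_besselI_sub_sub_zero hla hmu]
  set q₀ : ℤ := (((la + rho N) 0 : ℕ) : ℤ) - (((mu + rho N) 0 : ℕ) : ℤ) with hq₀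
  rw [tsum_eq_single q₀ (fun q hq => if_neg fun h => hq (by have := h 0; omega))]
  have hiff : (∀ i, (((la + rho N) i : ℕ) : ℤ) = (((mu + rho N) i : ℕ) : ℤ) + q₀) ↔
      ∀ i, (la i : ℤ) - mu i = (la 0 : ℤ) - mu 0 := by
    simp only [hq₀, Pi.add_apply, Nat.cast_add]
    exact forall_congr' fun i => by constructor <;> intro h <;> omega
  rw [if_congr hiff rfl rfl]

end Summit.Ventures.LatticeQCDFlow.Scoring
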